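import Mathlib
import HarnessLib
import Summits.QuantumFields.QCD.Theses.NestedDissectionSea

/-!
# Sketch — crux-ideate `RobustYangMills` (stmt-QuantumFields-13897), round 1, ideator 1

First-lemma signatures for the two crux idea cards of this seat. Nothing here is proved; every
declaration is a `Prop` (a checkable statement over existing tree declarations).

* Card `cross-plane-hankel-rigidity` — `CrossPlaneHankelNecessity` (Jaffe–Janssens-type necessity
  of cross-plane positivity, transplanted to the Wilson gauge measure: a translation-invariant
  family of time-stacked pairs of spacelike plaquettes perturbs the Wilson weight reflection-
  positively for all small couplings only if its Hankel matrix of stacking weights is positive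
  semidefinite) and `AdmissibleWashing` (the transfer lemma the card bets on: admissible
  perturbations of the crux's cone have block activities of vanishing variance along the
  scaling sequence).
* Card `axis-markov-response` — `SlabDecoupling` (the four-axis Markov/spectral decoupling
  hypothesis, in finite-torus form) and `AxisMarkovResponse` (first-order response bound: the
  covariance of a local observable with the total of a sup-small range-controlled perturbation is
  bounded uniformly in the torus — the engine of clause (iv)).
-/

namespace Summit.QuantumFields.QCD.Cruxes.RobustYangMills.SketchIdeator1

open scoped BigOperators ComplexOrder
open MeasureTheory Filter Finset
open Literature.MathematicalPhysics.QuantumLattice Literature.MathematicalPhysics.AQFT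
  Literature.MathematicalPhysics.QuantumFieldTheory

/-! ### Card `cross-plane-hankel-rigidity` -/

/-- Spacelike plaquette "energy" `N - Re tr ρ(U_p)` of the plaquette at `x` in the spatial plane
`(i, j)`. -/
noncomputable def plaqEnergy {d L N : ℕ} {G : Type} [Group G]
    (ρ : G →* Matrix (Fin N) (Fin N) ℂ) (U : GaugeConfig d L G) (x : Site d L) (i j : Fin d) : ℝ :=
  (N : ℝ) - (ρ (plaquetteHolonomy U x i j)).trace.re

/-- The translation-invariant family of TIME-STACKED PAIRS of parallel spacelike plaquettes with
stacking weights `c : ℕ → ℝ` (weight `c h` for two copies of the same spatial plaquette `h ≥ 1`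
time steps apart): `P_c(U) = ∑_x ∑_{0<i<j} ∑_{h} c h · s(U; x, i, j) · s(U; x + h e₀, i, j)`. -/
noncomputable def stackedPairs {d L N : ℕ} [NeZero d] [NeZero L] {G : Type} [Group G]
    (ρ : G →* Matrix (Fin N) (Fin N) ℂ) (c : ℕ → ℝ) (H : ℕ) (U : GaugeConfig d L G) : ℝ :=
  ∑ x : Site d L, ∑ i : Fin d, ∑ j : Fin d, ∑ h ∈ Finset.range H,
    if (0 : Fin d) < i ∧ i < j then
      c h * plaqEnergy ρ U x i j * plaqEnergy ρ U (x + Pi.single 0 ((h : ℕ) : ZMod L)) i j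
    else 0

/-- **First lemma of card `cross-plane-hankel-rigidity` (necessity of cross-plane positivity for
the Wilson gauge measure; Jaffe–Janssens Thm. 29(b) transplanted).** On an even torus, if the
Wilson weight tilted by `exp(ε · P_c)` stays reflection positive (tree shape of
`wilsonExpectation_reflectionPositive`, un-normalised) for all `ε ∈ [0, ε₀)`, then the Hankel
matrix `(c (a + a' + 1))_{a, a' ≥ 0}` of the stacking weights is positive semidefinite on vectors
supported below `H/2` (depth-`a` plaquette below the link plane couples to the height-`a'` one
above it with weight `c (a + a' + 1)`). Consequence drawn on the card: single-distance stackings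
(`c = δ_{h₀}`, `h₀ ≥ 2`) are never admissible; Laplace superpositions `c h = r^h` are. -/
def CrossPlaneHankelNecessity : Prop :=
  ∀ (d L N : ℕ) [NeZero d] [NeZero L] (G : Type) [Group G] [MeasurableSpace G]
    [TopologicalSpace G] [IsTopologicalGroup G] [CompactSpace G] [BorelSpace G]
    (ρ : G →* Matrix (Fin N) (Fin N) ℂ) (β : ℝ) (c : ℕ → ℝ) (H : ℕ),
    Even L → 4 * H ≤ L → Continuous ρ → 0 < β →
    (∃ ε₀ : ℝ, 0 < ε₀ ∧ ∀ ε : ℝ, 0 ≤ ε → ε < ε₀ →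
      ∀ F : GaugeConfig d L G → ℂ, Measurable F → (∃ C : ℝ, ∀ U, ‖F U‖ ≤ C) →
        IsPositiveTimeObservable F →
          0 ≤ wilsonExpectation ρ β fun U =>
            (starRingEnd ℂ) (F U.timeReflect) * F U *
              ((Real.exp (ε * stackedPairs ρ c H U) : ℝ) : ℂ)) →
    ∀ v : ℕ → ℝ, (∀ a, H / 2 ≤ a → v a = 0) →
      0 ≤ ∑ a ∈ Finset.range H, ∑ a' ∈ Finset.range H, v a * v a' * c (a + a' + 1)

/-- **Transfer lemma of card `cross-plane-hankel-rigidity` ("UV washing of the admissible cone").**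
With the crux's own quantifier prefix and admissibility predicate (h1)–(h3) (range control is
not even needed for the bet), every admissible family has block activities whose VARIANCE under
the unperturbed Wilson measure at the sequence's coupling vanishes along `k`, uniformly in the
torus `S ≥ L_k` and in the polymer: the sup-budget `η` per `ℓ₀`-block is attained only on ordered
configurations, typical configurations see an `(a_k/ℓ₀)^4` fraction of it. (Statement of the
BET; the card's `Transfer:` C⁺ is RobustYangMills at `W ≡ 0` for all a.f. sequences ∧ this.) -/
def AdmissibleWashing : Prop :=
  let G := ↥(Matrix.specialUnitaryGroup (Fin 3) ℂ)
  let ρ : G →* Matrix (Fin 3) (Fin 3) ℂ := fundamentalRep (Fin 3)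
  ∀ (η₀ : ℝ), 0 < η₀ → ∀ (κ : ℝ), 0 ≤ κ →
  ∀ (a : ℕ → ℝ) (L : ℕ → ℕ), (∀ k, 0 < a k) → Tendsto a atTop (nhds 0) →
    Tendsto (fun k => a k * L k) atTop atTop →
  ∀ (β' : ℕ → ℝ) (Λ' : ℝ), 0 < Λ' → Tendsto (fun k => β' k - afBeta 0 Λ' (a k)) atTop (nhds 0) →
  ∀ ℓ₀ : ℝ, 0 < ℓ₀ →
    let η : ℝ := η₀ / max 1 (afBeta 0 Λ' ℓ₀)
    ∀ W : (k : ℕ) → (S : ℕ) → QuasiLocalGaugePerturbation 4 (2 * S + 1) G ⌊ℓ₀ / a k⌋₊,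
      (∀ᶠ k in atTop, ∀ S : ℕ, L k ≤ S →
        (∀ (v : Site 4 (2 * S + 1)) (U : GaugeConfig 4 (2 * S + 1) G),
            (W k S).total (torusConfigShift v U) = (W k S).total U) ∧
        (∀ U : GaugeConfig 4 (2 * S + 1) G,
            (W k S).total (GaugeConfig.timeReflect U) = (W k S).total U) ∧
        (∀ (π : Equiv.Perm (Fin 4)) (U : GaugeConfig 4 (2 * S + 1) G),
            (W k S).total (fun e => U (e.1 ∘ π, π.symm e.2)) = (W k S).total U) ∧
        (W k S).IsReflectionPositive ρ (β' k) ∧ (W k S).NormLE κ η) →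
      ∀ ε : ℝ, 0 < ε → ∀ᶠ k in atTop, ∀ S : ℕ, L k ≤ S →
        ∀ X : Finset (Site 4 (2 * S + 1)), X ∈ polymers ⌊ℓ₀ / a k⌋₊ →
          ∫ U, ((W k S).act X U - wilsonExpectation ρ (β' k) ((W k S).act X)) ^ 2
              ∂(wilsonMeasure (d := 4) (L := 2 * S + 1) ρ (β' k)) ≤ ε ^ 2

/-! ### Card `axis-markov-response` -/

/-- Edges of the torus `(ℤ/L)^4` lying in the coordinate-`i` slab `t₁ ≤ x_i ≤ t₂`
(representatives in `{0,…,L-1}`). -/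
def slabEdges {L : ℕ} (i : Fin 4) (t₁ t₂ : ℕ) : Set (Edge 4 L) :=
  {e | t₁ ≤ (e.1 i).val ∧ (e.1 i).val ≤ t₂}

/-- **Four-axis slab decoupling at rate `m`** for a probability measure `μ` on torus
configurations: bounded measurable functionals of two coordinate-`i` slabs separated by at least
`n` lattice steps on BOTH sides of the circle `ℤ/L` have covariance at most
`‖F‖_∞ ‖G‖_∞ e^{-m n}`, for every axis `i`. For the Wilson measure (and every admissible perturbed
measure of the crux, all RP in the four axis directions by (h1)–(h2)) this is the spectral
reading of the uniform lattice gap — the transfer matrix in direction `i` has no spectrum in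
`(e^{-m}, 1)` — with OS norms bounded by sup norms. -/
def SlabDecoupling {L : ℕ} {G : Type} [MeasurableSpace G]
    (μ : Measure (GaugeConfig 4 L G)) (m : ℝ) : Prop :=
  ∀ (i : Fin 4) (t₁ t₂ t₃ t₄ n : ℕ) (F G₁ : GaugeConfig 4 L G → ℝ) (cF cG : ℝ),
    Measurable F → Measurable G₁ → (∀ U, |F U| ≤ cF) → (∀ U, |G₁ U| ≤ cG) →
    DependsOn F (slabEdges i t₁ t₂) → DependsOn G₁ (slabEdges i t₃ t₄) →
    t₁ ≤ t₂ → t₂ + n < t₃ → t₃ ≤ t₄ → t₄ + n < t₁ + L →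
      |∫ U, F U * G₁ U ∂μ - (∫ U, F U ∂μ) * ∫ U, G₁ U ∂μ| ≤ cF * cG * Real.exp (-(m * n))

/-- **First lemma of card `axis-markov-response` (first-order response on the cone, finite torus,
no limits).** There is a universal `c₀` such that: if the perturbed measure `μ_{β,W}` has four-axis
slab decoupling at rate `m > 0`, then for every perturbation direction `W'` that is sup-small in
the weighted norm (`NormLE κ δ`, `κ ≥ 1`) and RANGE-CONTROLLED (the crux's (h4)), and every
bounded observable `F` of an `r`-cube of blocks, the covariance of `F` with the TOTAL of `W'` —
the derivative of `⟨F⟩` along `W ↦ W + tW'` — is bounded by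
`c₀ · cF · δ · r^4 / (1 - exp(-min(m b, κ)/2))^4`, uniformly in the torus side. Summing the
derivative along an admissible interpolation gives clause (iv) of the crux with `k`-uniform
constants once `m = Δ a_k`, `b = ⌊ℓ₀/a_k⌋` (so `m b ≈ Δ ℓ₀`). -/
def AxisMarkovResponse : Prop :=
  ∃ c₀ : ℝ, 0 < c₀ ∧
  ∀ (S b N : ℕ) (G : Type) [Group G] [MeasurableSpace G] [TopologicalSpace G]
    [IsTopologicalGroup G] [CompactSpace G] [BorelSpace G]
    (ρ : G →* Matrix (Fin N) (Fin N) ℂ) (β m κ δ : ℝ)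
    (W W' : QuasiLocalGaugePerturbation 4 (2 * S + 1) G b),
    1 ≤ b → 0 < m → 1 ≤ κ → 0 ≤ δ →
    SlabDecoupling (W.perturbedMeasure ρ β) m →
    W'.NormLE κ δ →
    (∀ X : Finset (Site 4 (2 * S + 1)), X ∈ polymers b → (∃ U : GaugeConfig 4 (2 * S + 1) G, W'.act X U ≠ 0) →
      ∀ y ∈ X, ∀ y' ∈ X, ∀ i : Fin 4, (y i - y' i).val ≤ b * X.card ∨ (y' i - y i).val ≤ b * X.card) →
    ∀ (r : ℕ) (F : GaugeConfig 4 (2 * S + 1) G → ℝ) (cF : ℝ), Measurable F → (∀ U, |F U| ≤ cF) →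
      DependsOn F {e | ∀ i : Fin 4, (e.1 i).val < r * b} →
        |W.expectation ρ β (fun U => F U * W'.total U) -
            W.expectation ρ β F * W.expectation ρ β W'.total| ≤
          c₀ * cF * δ * (r : ℝ) ^ 4 / (1 - Real.exp (-(min (m * b) κ / 2))) ^ 4

end Summit.QuantumFields.QCD.Cruxes.RobustYangMills.SketchIdeator1
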